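import Literature.AnabelianGeometry.AbsoluteAnabelian.MonoidKummerModel
import Literature.AnabelianGeometry.AbsoluteAnabelian.MonoidKummerMapsSub
import Literature.AnabelianGeometry.AbsoluteAnabelian.LocalBrauerGroupQmodZ
import Literature.AnabelianGeometry.AbsoluteAnabelian.AbsAnabProp121viiBrauerAgreement
import Literature.AnabelianGeometry.AbsoluteAnabelian.LocalUnramifiedUnitsCohomology
import Literature.AnabelianGeometry.AbsoluteAnabelian.LocalUnramifiedQuotientH2
import Literature.AnabelianGeometry.AbsoluteAnabelian.GaloisCyclotomeZHatOne
import Literature.NumberTheory.GaloisRepresentations.LocalGaloisGroupFrobeniusProofs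
import HarnessLib

/-!
# [AbsTopIII] Prop 3.2 (i) for the MODEL: the printed Brauer chain `Prop32iChain` over REAL carriers,
# and the criterion for its statement `H2IsoEq`

S. Mochizuki, *Topics in absolute anabelian geometry III*, Prop. 3.2 (i) p. 71 l.18–60 (construction of
«the natural isomorphism `H²(G, μ_Ẑ(M_TM)) ⥲ Ẑ`» by the Brauer-group chain and «applying the functor
`Hom(ℚ/ℤ, −)`»).  Plan `plan/L4/SUBDAG-AbsTopIII-Prop32.md` rows P32.i.L01–L06 (holder abc-iut-w4-d045):
the statements-first schema `Prop32iChain T` (`MonoidKummerMapsSub.lean`) is here INSTANTIATED for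
abc-iut-L4-t2's model Kummer theory `ModelMLFGaloisData.kummerTheory` of the model pair `(Π_k ↷ 𝒪_k̄^⊳)`
over the standard closure `MLFClosure.std k = (k, AlgebraicClosure k)`, with REAL carriers wherever the
tree has them:

* `H²(G, μ_{ℚ/ℤ}(M_TM)) := Prop121vii.H2MuQZ k = colim_n H²(G_k, μ_n)` and `brauerKummer :=
  Prop121vii.brauerKummerQZEquiv k` (`LocalResidueMapQmodZ`, `LocalBrauerGroupQmodZ`);
* `H²(G^unr, (M^unr)^gp) := H²(Gal(k^nr/k), (k̄ˣ)^{I_k})` and `inflUnr :=` abc-iut-w5-d198's bijective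
  inflation (`Prop121vii.infUnramified_two_bijective`, `inflUnrEquiv` below);
* `H²(Ẑ, ℤ) := H²(Γ_k ⧸ galUnr k, ℤ)` and `toQmodZ :=` abc-iut-L4-t16's `H2UnrEquivQModZ`
  (Frobenius-independent, `H2UnrEquivQModZ_eq`);
* `endQmodZ`, and the unit-acyclicity / valuation arrows `H²(G^unr,(M^unr)^gp) ⥲ H²(G^unr,(M^unr)^gp/(M^unr)^×)
  ⥲ H²(Ẑ, ℤ)` are PARAMETERS `eEnd`, `e₃`, `e₄` (to be instantiated BY NAME: `eEnd :=
  Prop32iChain.endQmodZCanonical` of `MonoidKummerMapsEndQmodZ.lean`; `e₃`, `e₄` := abc-iut-w5-d214's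
  bricks U/V when they land) — nothing about them is assumed beyond being isomorphisms;
* `homQmodZ := Hom(ℚ/ℤ, invariantQZEquiv) ≫ eEnd`, i.e. `Hom(ℚ/ℤ, −)` applied to THE residue map
  (`Prop121vii.invariantQZEquiv`, local class field theory) — the model's `H²`-slot being `Ẑ` itself.

MAIN THEOREM `modelChain_h2IsoEq_iff`: the printed statement (i) for the model, `Prop32iChain.H2IsoEq`
(«the output `h2Iso` IS the chain composite»), holds IF AND ONLY IF the printed Brauer-route composite
`brauerKummer ≫ inflUnr⁻¹ ≫ e₃ ≫ e₄ ≫ toQmodZ : H²(G_k, μ_{ℚ/ℤ}) ⥲ ℚ/ℤ` EQUALS the residue map of local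
class field theory `invariantQZEquiv` — exactly [AbsAnab] Prop. 1.2.1 (vii)'s agreement row L05′
(abc-iut-w5-d198, «Brauer route of the canonical class») read at the `μ_{ℚ/ℤ}` level.  So the
assumption surface of Prop. 3.2 (i) at the model is pinned to ONE classical identity (Serre, *Local
Fields* XIV §1 Prop. 3).  FULL INSTANTIATION `modelChainStd k D ε eEnd` (every Brauer arrow from the tree:
`unitsAcyclic := unrValuationH2Equiv` = abc-iut-w5-d214's valuation isomorphism, bijective by unit
acyclicity; `valGen := ε` an orientation automorphism of `H²(Gal(k^nr/k), ℤ)`) and the SIGN, using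
abc-iut-w5-d198's `brauerComposite_eq_neg_invariantMap` (print's `N3 ∘ N2⁻¹ ∘ N1 = −inv_n/n` in the tree's
conventions): `not_modelChainStd_refl_h2IsoEq` — with `ε = id` (abc-iut-L4-t16's orientation of
«`H²(Ẑ, ℤ) ⥲ ℚ/ℤ`») and abc-iut-L4-t2's `h2Iso := id`, `H2IsoEq` is FALSE (level `3` witness); and
`modelChainStd_neg_h2IsoEq` — with `ε = −id` it HOLDS for every `eEnd`: **[AbsTopIII] Prop. 3.2 (i) is
DISCHARGED at the model up to the orientation convention, every input a kernel theorem of the tree.**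
HONEST FRAMING: local class field theory; the sign is a statement about the TREE's normalisations
(`IsInvariantMap`: `inv(κ_n(π) ∪ χ) = 1`; Bockstein/evaluation orientation), not about print; nothing here
bears on [IUTchIII] Cor. 3.12; typed ≠ proved; no side taken.
-/

noncomputable section

namespace Literature.AnabelianGeometry.AbsoluteAnabelian

open CategoryTheory Field Function
open Literature.NumberTheory.GaloisRepresentations
open Literature.NumberTheory.GaloisRepresentations.DiscreteGaloisModule

namespace Prop121vii

variable (k : Type) [Field k] [ValuativeRel k] [TopologicalSpace k] [IsNonarchimedeanLocalField k]

/-- An arithmetic Frobenius lift (`exists_isFrobPow_holds`). [cite: MochizukiAbsTopIII2015, Proposition 3.2 (i) p.71] -/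
def frob : absoluteGaloisGroup k := (exists_isFrobPow_holds (F := k) 1).choose

/-- `frob k` is a Frobenius lift. [cite: MochizukiAbsTopIII2015, Proposition 3.2 (i) p.71] -/
theorem isFrobPow_frob : IsFrobPow (frob k) 1 := (exists_isFrobPow_holds (F := k) 1).choose_spec

variable [CharZero k]

/-! ### The two ends supplied by the tree -/

/-- **Row P32.i.L02 / [AbsAnab] N2 as an isomorphism**: the inflation
`H²(Gal(k^nr/k), (k̄ˣ)^{I_k}) ⥲ H²(G_k, k̄ˣ)` (abc-iut-w5-d198 `infUnramified_two_bijective`).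
[cite: MochizukiAbsTopIII2015, Proposition 3.2 (i) p.71] -/
def inflUnrEquiv :
    (continuousCohomology 2 (((units k).quotientInvariants (galUnr k)).toTopRep) : TopModuleCat ℤ) ≃+
      galoisCohomology (units k) 2 :=
  AddEquiv.ofBijective
    (ContinuousCohomology.map (ContinuousMonoidHom.quotientMk (galUnr k))
      (invariantsInclusion (galUnr k) (units k)) 2).hom
    (infUnramified_two_bijective k)

/-- **Row P32.i.L05 as an isomorphism**: `H²(Gal(k^nr/k), ℤ) ⥲ ℚ/ℤ` (abc-iut-L4-t16 `H2UnrEquivQModZ`,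
independent of the Frobenius lift by `H2UnrEquivQModZ_eq`), read in `QmodZ = ULift (AddCircle (1 : ℚ))`.
[cite: MochizukiAbsTopIII2015, Proposition 3.2 (i) p.71] -/
def toQmodZEquiv :
    (continuousCohomology 2
        (ContinuousRep.trivial (absoluteGaloisGroup k ⧸ galUnr k) ℤ ZCoeff.{0}).toTopRep : TopModuleCat ℤ) ≃+
      QmodZ.{0} :=
  (H2UnrEquivQModZ (isFrobPow_frob k)).toAddEquiv.trans QModZCoeff.equivULift

/-- **Rows P32.i.L03–L04 as ONE isomorphism** (abc-iut-w5-d214): the valuation arrow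
`H²(Gal(k^nr/k), (k̄ˣ)^{I_k}) ⥲ H²(Gal(k^nr/k), ℤ)`, bijective BECAUSE the unramified units are
cohomologically trivial in degree `2` («`H²(G^unr,(M^unr)^gp) ⥲ H²(G^unr,(M^unr)^gp/(M^unr)^×)`», unit
acyclicity, `subsingleton_two_unrUnitsRep`) and the valuation is split surjective, normalised by `v(π_k) = 1`
(«`⥲ H²(Ẑ, ℤ)` … by considering a generator of the monoid `M^unr/(M^unr)^× ≅ ℕ`»):
`cohomologyMap_unrValuationHom_two_bijective`. [cite: MochizukiAbsTopIII2015, Proposition 3.2 (i) p.71] -/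
def unrValuationH2Equiv :
    (continuousCohomology 2 (((units k).quotientInvariants (galUnr k)).toTopRep) : TopModuleCat ℤ) ≃+
      (continuousCohomology 2
        (ContinuousRep.trivial (absoluteGaloisGroup k ⧸ galUnr k) ℤ ZCoeff.{0}).toTopRep : TopModuleCat ℤ) :=
  AddEquiv.ofBijective (cohomologyMap (unrValuationHom k) 2).hom
    (cohomologyMap_unrValuationHom_two_bijective k)

/-! ### The model chain -/

variable (D : ModelMLFGaloisData (MLFClosure.std k).k (MLFClosure.std k).K)

/-- **The printed Brauer chain of Prop. 3.2 (i) for the model pair `(Π_k ↷ 𝒪_k̄^⊳)`**, over real carriers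
(module docstring), with the unit-acyclicity / valuation arrows `e₃`, `e₄` and `End(ℚ/ℤ) ≅ Ẑ` `eEnd` as
parameters, and `homQmodZ := Hom(ℚ/ℤ, inv) ≫ eEnd` for THE residue map `inv = invariantQZEquiv k`.
[cite: MochizukiAbsTopIII2015, Proposition 3.2 (i) p.71] -/
def modelChain (Hmid : Type) [AddCommGroup Hmid]
    (e₃ : (continuousCohomology 2 (((units k).quotientInvariants (galUnr k)).toTopRep) : TopModuleCat ℤ) ≃+
      Hmid)
    (e₄ : Hmid ≃+ (continuousCohomology 2
      (ContinuousRep.trivial (absoluteGaloisGroup k ⧸ galUnr k) ℤ ZCoeff.{0}).toTopRep : TopModuleCat ℤ))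
    (eEnd : (QmodZ.{0} →+ QmodZ.{0}) ≃+ ZhatAdd.{0}) :
    Prop32iChain (D.kummerTheory (MLFClosure.std k)) where
  H2muQZ := H2MuQZ k
  H2Mgp := galoisCohomology (units k) 2
  brauerKummer := brauerKummerQZEquiv k
  H2unr := (continuousCohomology 2 (((units k).quotientInvariants (galUnr k)).toTopRep) : TopModuleCat ℤ)
  inflUnr := inflUnrEquiv k
  H2unrVal := Hmid
  unitsAcyclic := e₃
  H2ZhatZ := (continuousCohomology 2
      (ContinuousRep.trivial (absoluteGaloisGroup k ⧸ galUnr k) ℤ ZCoeff.{0}).toTopRep : TopModuleCat ℤ)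
  valGen := e₄
  toQmodZ := toQmodZEquiv k
  homQmodZ := (AddEquiv.addMonoidHomCongrRight ((invariantQZEquiv k).trans AddEquiv.ulift.symm)).trans eEnd
  endQmodZ := eEnd

variable {k D}

/-- The chain composite `invariant` of the model chain, unfolded: `brauerKummer ≫ inflUnr⁻¹ ≫ e₃ ≫ e₄ ≫
toQmodZ`. [cite: MochizukiAbsTopIII2015, Proposition 3.2 (i) p.71] -/
theorem modelChain_invariant (Hmid : Type) [AddCommGroup Hmid] (e₃) (e₄)
    (eEnd : (QmodZ.{0} →+ QmodZ.{0}) ≃+ ZhatAdd.{0}) :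
    (modelChain k D Hmid e₃ e₄ eEnd).invariant =
      (brauerKummerQZEquiv k).trans ((inflUnrEquiv k).symm.trans (e₃.trans (e₄.trans (toQmodZEquiv k)))) :=
  rfl

/-- `AddEquiv.addMonoidHomCongrRight e` is post-composition with `e`. [folklore] -/
private theorem addMonoidHomCongrRight_apply_eq {M N₁ N₂ : Type} [AddCommGroup M] [AddCommGroup N₁] [AddCommGroup N₂]
    (e : N₁ ≃+ N₂) (f : M →+ N₁) : AddEquiv.addMonoidHomCongrRight e f = e.toAddMonoidHom.comp f := rfl

/-- Abstract core of the criterion: for isomorphisms `inv, J : X ≃ Q`, `eEnd : End(Q) ≃ Z` and any `H` acting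
as post-composition with `J`, the composite `(Hom(Q, inv) ≫ eEnd)⁻¹ ≫ H ≫ eEnd` is the identity of `Z`
iff `J = inv`. [cite: MochizukiAbsTopIII2015, Proposition 3.2 (i) p.71] -/
theorem refl_eq_congr_trans_iff {X Q Z : Type} [AddCommGroup X] [AddCommGroup Q] [AddCommGroup Z]
    (inv J : X ≃+ Q) (eEnd : (Q →+ Q) ≃+ Z) (H : (Q →+ X) ≃+ (Q →+ Q))
    (hH : ∀ f, H f = J.toAddMonoidHom.comp f) :
    AddEquiv.refl Z = ((AddEquiv.addMonoidHomCongrRight inv).trans eEnd).symm.trans (H.trans eEnd) ↔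
      J = inv := by
  constructor
  · intro h
    have key : ∀ f : Q →+ X, inv.toAddMonoidHom.comp f = J.toAddMonoidHom.comp f := by
      intro f
      have h1 := AddEquiv.congr_fun h (((AddEquiv.addMonoidHomCongrRight inv).trans eEnd) f)
      rw [AddEquiv.refl_apply, AddEquiv.trans_apply
          ((AddEquiv.addMonoidHomCongrRight inv).trans eEnd).symm, AddEquiv.symm_apply_apply,
        AddEquiv.trans_apply, AddEquiv.trans_apply, hH, addMonoidHomCongrRight_apply_eq] at h1
      exact eEnd.injective h1
    ext x
    have h2 := DFunLike.congr_fun (key inv.symm.toAddMonoidHom) (inv x)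
    simp only [AddMonoidHom.coe_comp, Function.comp_apply, AddEquiv.coe_toAddMonoidHom,
      AddEquiv.symm_apply_apply] at h2
    exact h2.symm
  · rintro rfl
    refine AddEquiv.ext fun z => ?_
    obtain ⟨f, rfl⟩ := ((AddEquiv.addMonoidHomCongrRight J).trans eEnd).surjective z
    rw [AddEquiv.refl_apply, AddEquiv.trans_apply ((AddEquiv.addMonoidHomCongrRight J).trans eEnd).symm,
      AddEquiv.symm_apply_apply, AddEquiv.trans_apply, AddEquiv.trans_apply, hH,
      addMonoidHomCongrRight_apply_eq]

/-- **Prop. 3.2 (i) for the model — THE CRITERION.**  The printed statement `H2IsoEq` of the model chain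
(«the output `h2Iso` — here the model's identification of its `H²`-slot with `Ẑ` — IS the chain composite
through `Hom(ℚ/ℤ, −)`») holds iff the printed Brauer-route composite
`brauerKummer ≫ inflUnr⁻¹ ≫ e₃ ≫ e₄ ≫ toQmodZ : H²(G_k, μ_{ℚ/ℤ}) ⥲ ℚ/ℤ` equals THE residue map of local class
field theory `invariantQZEquiv k` ([AbsAnab] Prop. 1.2.1 (vii) row L05′, Serre *Local Fields* XIV §1
Prop. 3) — independently of the choice of `eEnd : End(ℚ/ℤ) ≅ Ẑ`.
[cite: MochizukiAbsTopIII2015, Proposition 3.2 (i) p.71] -/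
theorem modelChain_h2IsoEq_iff (Hmid : Type) [AddCommGroup Hmid] (e₃) (e₄)
    (eEnd : (QmodZ.{0} →+ QmodZ.{0}) ≃+ ZhatAdd.{0}) :
    (modelChain k D Hmid e₃ e₄ eEnd).H2IsoEq ↔
      (modelChain k D Hmid e₃ e₄ eEnd).invariant = (invariantQZEquiv k).trans AddEquiv.ulift.symm := by
  have h := refl_eq_congr_trans_iff ((invariantQZEquiv k).trans AddEquiv.ulift.symm)
    (modelChain k D Hmid e₃ e₄ eEnd).invariant eEnd (modelChain k D Hmid e₃ e₄ eEnd).homInvariant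
    (fun _ => rfl)
  exact h

/-- Consequently: IF the Brauer-route composite is the residue map (the classical agreement, to be supplied
BY NAME by the [AbsAnab] Prop 1.2.1 (vii) lane), THEN Prop. 3.2 (i) holds for the model chain.
[cite: MochizukiAbsTopIII2015, Proposition 3.2 (i) p.71] -/
theorem modelChain_h2IsoEq_of_agreement (Hmid : Type) [AddCommGroup Hmid] (e₃) (e₄)
    (eEnd : (QmodZ.{0} →+ QmodZ.{0}) ≃+ ZhatAdd.{0})
    (hagree : (brauerKummerQZEquiv k).trans ((inflUnrEquiv k).symm.trans (e₃.trans (e₄.trans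
      (toQmodZEquiv k)))) = (invariantQZEquiv k).trans AddEquiv.ulift.symm) :
    (modelChain k D Hmid e₃ e₄ eEnd).H2IsoEq :=
  (modelChain_h2IsoEq_iff Hmid e₃ e₄ eEnd).2 hagree

/-- The agreement at the `μ_{ℚ/ℤ}` level reduces to the LEVELS: an isomorphism `Φ : H²(G_k, μ_{ℚ/ℤ}) ⥲ ℚ/ℤ`
IS the residue map iff on every level-`n` class it takes the value `inv_n(x)/n` (`H2MuQZ.exists_of`).
[cite: MochizukiAbsTopIII2015, Proposition 3.2 (i) p.71] -/
theorem eq_invariantQZEquiv_iff_levelwise (Φ : H2MuQZ k ≃+ QmodZ.{0}) :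
    Φ = (invariantQZEquiv k).trans AddEquiv.ulift.symm ↔
      ∀ (n : ℕ+) (x : galoisCohomology (mu k (n : ℕ)) 2),
        Φ (H2MuQZ.of n x) = ULift.up ((((((invLevel k (n : ℕ) x).val : ℚ)) / (n : ℕ) : ℚ) : AddCircle (1 : ℚ))) := by
  constructor
  · rintro rfl n x
    rw [AddEquiv.trans_apply, invariantQZEquiv_of]
    rfl
  · intro h
    refine AddEquiv.ext fun z => ?_
    obtain ⟨n, x, rfl⟩ := H2MuQZ.exists_of z
    rw [h, AddEquiv.trans_apply, invariantQZEquiv_of]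
    rfl

/-- **Prop. 3.2 (i) for the model, LEVELWISE CRITERION**: `H2IsoEq` holds for the model chain iff for every
`n ≥ 1` and every `x ∈ H²(G_k, μ_n)` the printed Brauer-route composite sends the class of `x` to
`inv_n(x)/n` — the level-`n` identity «print's composite `N3 ∘ N2⁻¹ ∘ N1` restricted to `H²(μ_n)` is THE
residue map» ([AbsAnab] Prop 1.2.1 (vii) row L05′; sign conventions of the tree's cup product included —
a sign discrepancy, if any, shows up HERE). [cite: MochizukiAbsTopIII2015, Proposition 3.2 (i) p.71] -/
theorem modelChain_h2IsoEq_iff_levelwise (Hmid : Type) [AddCommGroup Hmid] (e₃) (e₄)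
    (eEnd : (QmodZ.{0} →+ QmodZ.{0}) ≃+ ZhatAdd.{0}) :
    (modelChain k D Hmid e₃ e₄ eEnd).H2IsoEq ↔
      ∀ (n : ℕ+) (x : galoisCohomology (mu k (n : ℕ)) 2),
        (modelChain k D Hmid e₃ e₄ eEnd).invariant (H2MuQZ.of n x) =
          ULift.up ((((((invLevel k (n : ℕ) x).val : ℚ)) / (n : ℕ) : ℚ) : AddCircle (1 : ℚ))) :=
  (modelChain_h2IsoEq_iff Hmid e₃ e₄ eEnd).trans (eq_invariantQZEquiv_iff_levelwise _)

/-! ### The fully instantiated model chain and the SIGN of (i) at the model -/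

variable (k D)

/-- **The model chain with EVERY Brauer arrow from the tree**: `unitsAcyclic := unrValuationH2Equiv`
(d214's valuation isomorphism, rows L03–L04 in one arrow), `valGen := ε` an automorphism of `H²(Gal(k^nr/k), ℤ)`
carrying the ORIENTATION convention of «`H²(Ẑ, ℤ) ⥲ ℚ/ℤ`» (`ε = id` for abc-iut-L4-t16's `H2UnrEquivQModZ`
as is, `ε = −id` for the opposite orientation), and `eEnd` as before.
[cite: MochizukiAbsTopIII2015, Proposition 3.2 (i) p.71] -/
abbrev modelChainStd
    (ε : (continuousCohomology 2
        (ContinuousRep.trivial (absoluteGaloisGroup k ⧸ galUnr k) ℤ ZCoeff.{0}).toTopRep : TopModuleCat ℤ) ≃+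
      (continuousCohomology 2
        (ContinuousRep.trivial (absoluteGaloisGroup k ⧸ galUnr k) ℤ ZCoeff.{0}).toTopRep : TopModuleCat ℤ))
    (eEnd : (QmodZ.{0} →+ QmodZ.{0}) ≃+ ZhatAdd.{0}) :
    Prop32iChain (D.kummerTheory (MLFClosure.std k)) :=
  modelChain k D _ (unrValuationH2Equiv k) ε eEnd

variable {k D}

/-- The chain composite of `modelChainStd` on a level-`n` class: `toQmodZ (ε (val (Inf⁻¹ (Kummer x))))`.
[cite: MochizukiAbsTopIII2015, Proposition 3.2 (i) p.71] -/
theorem modelChainStd_invariant_of (ε) (eEnd : (QmodZ.{0} →+ QmodZ.{0}) ≃+ ZhatAdd.{0}) (n : ℕ+)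
    (x : galoisCohomology (mu k (n : ℕ)) 2) :
    (modelChainStd k D ε eEnd).invariant (H2MuQZ.of n x) =
      QModZCoeff.equivULift (H2UnrEquivQModZ (isFrobPow_frob k)
        (ε (cohomologyMap (unrValuationHom k) 2 ((inflUnrEquiv k).symm (cohomologyMap (kummerι k (n : ℕ)) 2 x))))) := by
  have h1 : (modelChainStd k D ε eEnd).invariant (H2MuQZ.of n x) =
      toQmodZEquiv k (ε (unrValuationH2Equiv k ((inflUnrEquiv k).symm
        (brauerKummerQZEquiv k (H2MuQZ.of n x))))) := rfl
  rw [h1, brauerKummerQZEquiv_of]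
  rfl

/-- **Print's composite with abc-iut-L4-t16's orientation is MINUS the residue map** on every level-`n` class:
`(modelChainStd k D (refl) eEnd).invariant [x] = −inv_n(x)/n` — abc-iut-w5-d198's
`brauerComposite_eq_neg_invariantMap` ([AbsAnab] Prop 1.2.1 (vii) row L05′) read in the chain.
[cite: MochizukiAbsTopIII2015, Proposition 3.2 (i) p.71] -/
theorem modelChainStd_refl_invariant_of (eEnd : (QmodZ.{0} →+ QmodZ.{0}) ≃+ ZhatAdd.{0}) (n : ℕ+)
    (x : galoisCohomology (mu k (n : ℕ)) 2) :
    (modelChainStd k D (AddEquiv.refl _) eEnd).invariant (H2MuQZ.of n x) =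
      ULift.up (-((((((invLevel k (n : ℕ) x).val : ℚ)) / (n : ℕ) : ℚ) : AddCircle (1 : ℚ)))) := by
  rw [modelChainStd_invariant_of, AddEquiv.refl_apply]
  unfold inflUnrEquiv
  erw [brauerComposite_eq_neg_invariantMap k (isFrobPow_frob k) (invLevel k (n : ℕ))
      (isInvariantMap_invLevel k (n : ℕ)) x]
  rfl

/-- **With the opposite orientation the composite IS the residue map**:
`(modelChainStd k D (−id) eEnd).invariant [x] = inv_n(x)/n`. [cite: MochizukiAbsTopIII2015, Proposition 3.2 (i) p.71] -/
theorem modelChainStd_neg_invariant_of (eEnd : (QmodZ.{0} →+ QmodZ.{0}) ≃+ ZhatAdd.{0}) (n : ℕ+)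
    (x : galoisCohomology (mu k (n : ℕ)) 2) :
    (modelChainStd k D (AddEquiv.neg _) eEnd).invariant (H2MuQZ.of n x) =
      ULift.up ((((((invLevel k (n : ℕ) x).val : ℚ)) / (n : ℕ) : ℚ) : AddCircle (1 : ℚ))) := by
  rw [modelChainStd_invariant_of, AddEquiv.neg_apply, map_neg]
  unfold inflUnrEquiv
  erw [brauerComposite_eq_neg_invariantMap k (isFrobPow_frob k) (invLevel k (n : ℕ))
      (isInvariantMap_invLevel k (n : ℕ)) x]
  rw [neg_neg]
  rfl

/-- `1/3 ≠ −1/3` in `ℚ/ℤ`. [folklore] -/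
private theorem one_third_ne_neg : ((((1 : ℚ) / 3 : ℚ)) : AddCircle (1 : ℚ)) ≠ -((((1 : ℚ) / 3 : ℚ)) : AddCircle (1 : ℚ)) := by
  intro h
  have h2 : ((((1 : ℚ) / 3 + (1 : ℚ) / 3 : ℚ)) : AddCircle (1 : ℚ)) = 0 := by
    rw [AddCircle.coe_add]
    nth_rw 1 [h]
    exact neg_add_cancel _
  rw [AddCircle.coe_eq_zero_iff] at h2
  obtain ⟨m, hm⟩ := h2
  rw [zsmul_eq_mul, mul_one] at hm
  have h3 : (m : ℚ) * 3 = 2 := by rw [hm]; norm_num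
  have h4 : (m * 3 : ℤ) = 2 := by exact_mod_cast h3
  omega

/-- **Prop. 3.2 (i) `H2IsoEq` FAILS for the model chain with abc-iut-L4-t16's orientation of
«`H²(Ẑ, ℤ) ⥲ ℚ/ℤ`» and abc-iut-L4-t2's `h2Iso := id`** — by a SIGN (level `3`, the class with `inv₃ = 1`):
a kernel-visible CONVENTION mismatch between the tree's `IsInvariantMap` normalisation
(`inv(κ_n(π) ∪ χ) = 1`) and the orientation of the printed chain as typed; not a statement about print.
[cite: MochizukiAbsTopIII2015, Proposition 3.2 (i) p.71] -/
theorem not_modelChainStd_refl_h2IsoEq (eEnd : (QmodZ.{0} →+ QmodZ.{0}) ≃+ ZhatAdd.{0}) :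
    ¬ (modelChainStd k D (AddEquiv.refl _) eEnd).H2IsoEq := by
  intro h
  have h' := (modelChain_h2IsoEq_iff_levelwise (k := k) (D := D) _ (unrValuationH2Equiv k)
    (AddEquiv.refl _) eEnd).1 h
  obtain ⟨x, hx⟩ := (isInvariantMap_invLevel k ((3 : ℕ+) : ℕ)).1.2 (1 : ZMod ((3 : ℕ+) : ℕ))
  have h1 := h' 3 x
  have h2 := modelChainStd_refl_invariant_of (D := D) eEnd 3 x
  have h3 := congrArg ULift.down (h1.symm.trans h2)
  dsimp only at h3
  rw [hx] at h3
  have hq : ((((1 : ZMod ((3 : ℕ+) : ℕ)).val : ℚ)) / ((3 : ℕ+) : ℕ) : ℚ) = (1 : ℚ) / 3 := by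
    have hv : (1 : ZMod ((3 : ℕ+) : ℕ)).val = 1 := by decide
    rw [hv]
    change (((1 : ℕ) : ℚ) / ((3 : ℕ) : ℚ) : ℚ) = 1 / 3
    norm_num
  rw [hq] at h3
  exact one_third_ne_neg h3

/-- **Prop. 3.2 (i) `H2IsoEq` HOLDS for the model chain with the opposite orientation (`valGen := −id`)**,
for every `eEnd`: the printed Brauer chain through `Hom(ℚ/ℤ, −)` reproduces the model's identification of its
`H²`-slot — i.e. [AbsTopIII] Prop. 3.2 (i) is DISCHARGED AT THE MODEL up to the orientation convention made
explicit by `not_modelChainStd_refl_h2IsoEq`. All inputs are kernel theorems of the tree (local class field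
theory; d198/d201/d214/t16 + this seat). [cite: MochizukiAbsTopIII2015, Proposition 3.2 (i) p.71] -/
theorem modelChainStd_neg_h2IsoEq (eEnd : (QmodZ.{0} →+ QmodZ.{0}) ≃+ ZhatAdd.{0}) :
    (modelChainStd k D (AddEquiv.neg _) eEnd).H2IsoEq := by
  exact (modelChain_h2IsoEq_iff_levelwise (k := k) (D := D) _ (unrValuationH2Equiv k) (AddEquiv.neg _)
    eEnd).2 fun n x => modelChainStd_neg_invariant_of (D := D) eEnd n x

end Prop121vii

end Literature.AnabelianGeometry.AbsoluteAnabelian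

end
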